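import Literature.Topology.FourManifolds.GenericStageStepFiniteAtlas
import Literature.Topology.FourManifolds.HomotopyChartBoxes
import Literature.Geometry.Manifold.OpenSubmanifoldMFDeriv
import HarnessLib

/-!
# General position for homotopies of finitely many arcs, relative to the end pieces
# (Whitney 1936, §II Thm. 6 and §§8–9, for `m = 1`)

Topic `Literature/Topology/FourManifolds`; the general-position step of the proof of
`Literature.Topology.FourManifolds.arcs_ambientIsotopic_rel_of_homotopicRel`
(`OneHandleUniqueness.lean`: arcs homotopic rel ends are ambient isotopic rel ends and rel a
closed set the homotopies avoid).  Whitney's theorem *homotopic embeddings `Mᵐ → Nⁿ` are isotopic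
when `n ≥ 2m + 2`* (Milnor (1965), Thm. 8.4 and Remark) is proved in the tree for a **compact
boundaryless** source (`isSmoothlyIsotopic_of_contMDiff_homotopy_of_le`,
`HomotopicEmbeddingsIsotopicProofs.lean`), by an induction over chart boxes applying the generic
perturbation step `exists_boxPerturb_good` once per box.  Here the source is a finite union of
arcs and the perturbation must leave the end pieces of the arcs untouched; the same induction is
run on the **open** one-dimensional source `U = ⋃ⱼ {y ∈ ℝ¹ : |y₀ - 4j| < 1 + θ}` (one parameter
window per arc, an open subset of the model space `ℝ¹`, covered by one chart), with the
finite-atlas form of the step (`exists_boxPerturb_good_of_finite_atlas'`,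
`GenericStageStepFiniteAtlas.lean`): the boxes cover only the compact part
`[1/4, 3/4] × {|t| ≤ b}` of `ℝ × U`, their radii are so small that the band `|t| ≥ b + ε` is
never perturbed, the injectivity of the stage differential is carried through the induction on
the band as well (there the stages are the immersions `a₀ʲ`), and every perturbed point is good
(the step with `K = {ρ ≠ 0}`), so that at the end every stage is an injective immersion of the
whole source.

* `injective_mfderiv_comp_coord_iff` — a curve `φ : ℝ → X` read through the coordinate of `ℝ¹`,
  `w ↦ φ (w₀ - c)`, has injective differential at `z` iff `φ` has at `z₀ - c`;
* `exists_generalPosition_arcs` — **the general-position theorem for arcs**: given smooth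
  homotopies `gʲ : ℝ × ℝ → X` (`j < n`, `dim X ≥ 4`) with `gʲ (s, ·) = a₀ʲ` for `s ≤ 1/4`,
  `= a₁ʲ` for `s ≥ 3/4`, `gʲ (s, t) = a₀ʲ t` on the band `b ≤ |t| ≤ 1 + θ`, where `a₀ʲ`, `a₁ʲ`
  are smooth families of pairwise disjoint injective immersions on an open `W ⊇ [-1-2θ, 1+2θ]`,
  and `gʲ ([0, 1] × {|t| ≤ b + 2ε})` missing the closed set `Z`, there are smooth
  `Gʲ : ℝ × ℝ → X`, equal to `gʲ` for `s ∉ (1/8, 7/8)` and for `|t| ≥ b + ε`, still missing `Z`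
  there, such that for every `s` the curves `t ↦ Gʲ (s, t)`, `|t| ≤ 1 + θ/2`, are immersions,
  injective, and pairwise disjoint.

Everything here is proved; no definitions, no named facts.

## References

* H. Whitney, *Differentiable manifolds*, Ann. of Math. (2) 37 (1936), 645–680, §II Thm. 6,
  §§8–9. [Whitney1936]
* J. Milnor, *Lectures on the h-cobordism theorem* (1965), Thm. 8.4 and Remark (PDF p. 56 of the
  held copy). [MilnorHCobordism1965]
* M. W. Hirsch, *Differential Topology*, GTM 33 (1976), Ch. 3 §2 Thm. 2.5; Ch. 8 §1.
  [HirschDT1976]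
-/

open scoped Manifold ContDiff Topology
open Function Set Filter Metric

noncomputable section

namespace Literature.Topology.FourManifolds

open Literature.Geometry.Manifold

variable {d : ℕ} {X : Type*} [TopologicalSpace X] [ChartedSpace (EuclideanSpace ℝ (Fin d)) X]
  [IsManifold (𝓡 d) ∞ X]

/-! ### Curves read through the coordinate of `ℝ¹` -/

omit [IsManifold (𝓡 d) ∞ X] in
/-- **A curve read through the coordinate of `ℝ¹`.**  For `φ : ℝ → X` differentiable at
`z₀ - c`, the map `w ↦ φ (w₀ - c)` on `ℝ¹ = EuclideanSpace ℝ (Fin 1)` has injective differential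
at `z` iff `φ` has injective differential at `z₀ - c` (chain rule with the coordinate functional,
an isomorphism `ℝ¹ ≅ ℝ`). [folklore] -/
theorem injective_mfderiv_comp_coord_iff {φ : ℝ → X} {z : EuclideanSpace ℝ (Fin 1)} {c : ℝ}
    (hφ : MDifferentiableAt 𝓘(ℝ, ℝ) (𝓡 d) φ (z 0 - c)) :
    Injective (mfderiv (𝓡 1) (𝓡 d) (fun w : EuclideanSpace ℝ (Fin 1) => φ (w 0 - c)) z) ↔
      Injective (mfderiv 𝓘(ℝ, ℝ) (𝓡 d) φ (z 0 - c)) := by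
  have hπ' : HasFDerivAt (fun w : EuclideanSpace ℝ (Fin 1) => w 0 - c)
      (EuclideanSpace.proj (0 : Fin 1) : EuclideanSpace ℝ (Fin 1) →L[ℝ] ℝ) z :=
    ((EuclideanSpace.proj (0 : Fin 1) : EuclideanSpace ℝ (Fin 1) →L[ℝ] ℝ).hasFDerivAt
      (x := z)).sub_const c
  have hπ : HasMFDerivAt (𝓡 1) 𝓘(ℝ, ℝ) (fun w : EuclideanSpace ℝ (Fin 1) => w 0 - c) z
      (EuclideanSpace.proj (0 : Fin 1) : EuclideanSpace ℝ (Fin 1) →L[ℝ] ℝ) := hπ'.hasMFDerivAt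
  have hcomp := hφ.hasMFDerivAt.comp z hπ
  have heq : (fun w : EuclideanSpace ℝ (Fin 1) => φ (w 0 - c)) = φ ∘ fun w => w 0 - c := rfl
  rw [heq, hcomp.mfderiv, ContinuousLinearMap.coe_comp]
  have hinj : Injective (EuclideanSpace.proj (0 : Fin 1) : EuclideanSpace ℝ (Fin 1) → ℝ) := by
    intro w w' h
    refine PiLp.ext fun i => ?_
    fin_cases i
    exact h
  have hsurj : Surjective (EuclideanSpace.proj (0 : Fin 1) : EuclideanSpace ℝ (Fin 1) → ℝ) :=
    fun t => ⟨t • !₂[(1 : ℝ)], by simp⟩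
  exact ⟨fun h => h.of_comp_right hsurj, fun h => h.comp hinj⟩

/-! ### General position for arcs -/

set_option maxHeartbeats 1600000 in
/-- **General position for homotopies of finitely many arcs, rel the end pieces** (Whitney
(1936), §II Thm. 6 with §§8–9, `m = 1`, `n ≥ 4`; Milnor (1965), Thm. 8.4 and Remark; the
induction over chart boxes of the tree's `isSmoothlyIsotopic_of_contMDiff_homotopy_of_le`, run on
the open source `⋃ⱼ` (window of arc `j`) `⊆ ℝ¹` with `exists_boxPerturb_good_of_finite_atlas'`).
Hypotheses: `X` a Hausdorff manifold of dimension `d ≥ 4`; `0 < θ < 1`, `0 < ε`, `b + ε ≤ 1`;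
`a₀ʲ, a₁ʲ : ℝ → X` (`j : Fin n`) smooth, injective and immersive on an open
`W ⊇ [-1 - 2θ, 1 + 2θ]`, each family pairwise disjoint on `W`; `gʲ : ℝ × ℝ → X` smooth with
`gʲ (s, t) = a₀ʲ t` for `s ≤ 1/4`, `= a₁ʲ t` for `s ≥ 3/4`, `= a₀ʲ t` for `b ≤ |t|` (all for
`|t| ≤ 1 + θ`), and `gʲ (s, t) ∉ Z` (`Z` closed) for `s ∈ [0, 1]`, `|t| ≤ b + 2ε`.  Conclusion:
smooth `Gʲ : ℝ × ℝ → X` with `Gʲ = gʲ` wherever `s ≤ 1/8`, `s ≥ 7/8` or `|t| ≥ b + ε`;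
`Gʲ (s, t) ∉ Z` for `s ∈ [0, 1]`, `|t| ≤ b + 2ε`; for every `s` and `|t| ≤ 1 + θ/2` the
differential of `t ↦ Gʲ (s, t)` is injective; and for every `s` the points `Gʲ (s, t)`,
`|t| ≤ 1 + θ/2`, are pairwise distinct over all `(j, t)`.
[cite: Whitney1936, §II Thm. 6 and §§8–9] [cite: MilnorHCobordism1965, Thm. 8.4 and Remark (PDF p. 56)] -/
theorem exists_generalPosition_arcs [T2Space X] (hd : 4 ≤ d) {n : ℕ}
    {a₀ a₁ : Fin n → ℝ → X} {g : Fin n → ℝ × ℝ → X} {Z : Set X} {W : Set ℝ} {θ ε b : ℝ}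
    (hθ : 0 < θ) (hθ1 : θ < 1) (hε : 0 < ε) (hbε : b + ε ≤ 1)
    (hW : IsOpen W) (hWI : Icc (-1 - 2 * θ) (1 + 2 * θ) ⊆ W)
    (ha₀ : ∀ j, ContMDiffOn 𝓘(ℝ, ℝ) (𝓡 d) ∞ (a₀ j) W ∧ InjOn (a₀ j) W ∧
      ∀ t ∈ W, Injective (mfderiv 𝓘(ℝ, ℝ) (𝓡 d) (a₀ j) t))
    (ha₁ : ∀ j, ContMDiffOn 𝓘(ℝ, ℝ) (𝓡 d) ∞ (a₁ j) W ∧ InjOn (a₁ j) W ∧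
      ∀ t ∈ W, Injective (mfderiv 𝓘(ℝ, ℝ) (𝓡 d) (a₁ j) t))
    (hd₀ : ∀ j l, j ≠ l → ∀ t ∈ W, ∀ s ∈ W, a₀ j t ≠ a₀ l s)
    (hd₁ : ∀ j l, j ≠ l → ∀ t ∈ W, ∀ s ∈ W, a₁ j t ≠ a₁ l s)
    (hg : ∀ j, ContMDiff 𝓘(ℝ, ℝ × ℝ) (𝓡 d) ∞ (g j))
    (hg0 : ∀ j s t, s ≤ 1 / 4 → |t| ≤ 1 + θ → g j (s, t) = a₀ j t)
    (hg1 : ∀ j s t, 3 / 4 ≤ s → |t| ≤ 1 + θ → g j (s, t) = a₁ j t)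
    (hgb : ∀ j s t, b ≤ |t| → |t| ≤ 1 + θ → g j (s, t) = a₀ j t)
    (hZ : IsClosed Z) (hgZ : ∀ j, ∀ s ∈ Icc (0 : ℝ) 1, ∀ t, |t| ≤ b + 2 * ε → g j (s, t) ∉ Z) :
    ∃ G : Fin n → ℝ × ℝ → X,
      (∀ j, ContMDiff 𝓘(ℝ, ℝ × ℝ) (𝓡 d) ∞ (G j)) ∧
      (∀ j s t, (s ≤ 1 / 8 ∨ 7 / 8 ≤ s ∨ b + ε ≤ |t|) → G j (s, t) = g j (s, t)) ∧
      (∀ j, ∀ s ∈ Icc (0 : ℝ) 1, ∀ t, |t| ≤ b + 2 * ε → G j (s, t) ∉ Z) ∧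
      (∀ j s t, |t| ≤ 1 + θ / 2 →
        Injective (mfderiv 𝓘(ℝ, ℝ) (𝓡 d) (fun t => G j (s, t)) t)) ∧
      ∀ s j j' t t', |t| ≤ 1 + θ / 2 → |t'| ≤ 1 + θ / 2 → G j (s, t) = G j' (s, t') →
        j = j' ∧ t = t' := by
  classical
  -- ### points and distances in `ℝ¹`
  set e₀ : EuclideanSpace ℝ (Fin 1) := !₂[(1 : ℝ)] with he₀
  have he₀0 : e₀ 0 = 1 := by simp [he₀]
  have hsm0 : ∀ t : ℝ, (t • e₀) 0 = t := fun t => by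
    rw [PiLp.smul_apply, he₀0, smul_eq_mul, mul_one]
  have hpt : ∀ w : EuclideanSpace ℝ (Fin 1), w = (w 0) • e₀ := fun w => by
    refine PiLp.ext fun i => ?_
    fin_cases i
    simp [hsm0]
  have hdist : ∀ w w' : EuclideanSpace ℝ (Fin 1), dist w w' = |w 0 - w' 0| := fun w w' => by
    rw [EuclideanSpace.dist_eq, Fin.sum_univ_one, Real.sqrt_sq dist_nonneg, Real.dist_eq]
  have hproj : ContDiff ℝ ∞ fun w : EuclideanSpace ℝ (Fin 1) => w 0 :=
    (EuclideanSpace.proj (0 : Fin 1) : EuclideanSpace ℝ (Fin 1) →L[ℝ] ℝ).contDiff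
  have hprojc : Continuous fun w : EuclideanSpace ℝ (Fin 1) => w 0 :=
    (EuclideanSpace.proj (0 : Fin 1)).continuous
  have htW : ∀ t : ℝ, |t| < 1 + θ → t ∈ W := fun t ht => by
    obtain ⟨h1, h2⟩ := abs_lt.1 ht
    exact hWI ⟨by linarith, by linarith⟩
  -- ### the centres of the windows
  set c : Fin n → ℝ := fun j => 4 * (j : ℝ) with hc
  have hcsep : ∀ j l : Fin n, j ≠ l → 4 ≤ |c j - c l| := by
    intro j l hjl
    have hne : ((j : ℕ) : ℤ) - ((l : ℕ) : ℤ) ≠ 0 := by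
      intro h
      exact hjl (Fin.ext (by exact_mod_cast sub_eq_zero.1 h))
    have h1 : (1 : ℤ) ≤ |((j : ℕ) : ℤ) - ((l : ℕ) : ℤ)| := Int.one_le_abs hne
    have h2 : (1 : ℝ) ≤ |((j : ℕ) : ℝ) - ((l : ℕ) : ℝ)| := by exact_mod_cast h1
    have h3 : |c j - c l| = 4 * |((j : ℕ) : ℝ) - ((l : ℕ) : ℝ)| := by
      simp only [hc]
      rw [← mul_sub, abs_mul, abs_of_pos (by norm_num : (0 : ℝ) < 4)]
    rw [h3]
    linarith
  have huniq : ∀ (t : ℝ) (j l : Fin n), |t - c j| < 2 → |t - c l| < 2 → j = l := by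
    intro t j l hj hl
    by_contra hjl
    have h4 := hcsep j l hjl
    have : |c j - c l| ≤ |t - c j| + |t - c l| := by
      rw [show c j - c l = (t - c l) - (t - c j) by ring]
      exact (abs_sub _ _).trans (by rw [add_comm])
    linarith
  -- ### the source `U`: the union of the parameter windows
  set Uset : Set (EuclideanSpace ℝ (Fin 1)) := {w | ∃ j : Fin n, |w 0 - c j| < 1 + θ} with hUset
  have hUo : IsOpen Uset := by
    have : Uset = ⋃ j : Fin n, {w : EuclideanSpace ℝ (Fin 1) | |w 0 - c j| < 1 + θ} := by
      ext w
      simp [hUset]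
    rw [this]
    exact isOpen_iUnion fun j => isOpen_lt ((hprojc.sub continuous_const).abs) continuous_const
  set U : TopologicalSpace.Opens (EuclideanSpace ℝ (Fin 1)) := ⟨Uset, hUo⟩ with hU
  have hmemU : ∀ y : U, ∃ j : Fin n, |(y : EuclideanSpace ℝ (Fin 1)) 0 - c j| < 1 + θ :=
    fun y => y.2
  choose idx hidx using hmemU
  have hidx_eq : ∀ (y : U) (j : Fin n), |(y : EuclideanSpace ℝ (Fin 1)) 0 - c j| < 2 → idx y = j :=
    fun y j hj => huniq _ _ _ (by linarith [hidx y]) hj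
  -- the point of `U` with index `j` and coordinate `t`
  have hmk_mem : ∀ (j : Fin n) (t : ℝ), |t| < 1 + θ → (c j + t) • e₀ ∈ U := fun j t ht =>
    ⟨j, by rw [hsm0, add_sub_cancel_left]; exact ht⟩
  set mk : ∀ (j : Fin n) (t : ℝ), |t| < 1 + θ → U := fun j t ht => ⟨(c j + t) • e₀, hmk_mem j t ht⟩
    with hmk
  have hmk0 : ∀ (j : Fin n) (t : ℝ) (ht : |t| < 1 + θ),
      ((mk j t ht : U) : EuclideanSpace ℝ (Fin 1)) 0 = c j + t := fun j t ht => hsm0 _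
  have hidx_mk : ∀ (j : Fin n) (t : ℝ) (ht : |t| < 1 + θ), idx (mk j t ht) = j := fun j t ht =>
    hidx_eq _ _ (by rw [hmk0 j t ht, add_sub_cancel_left]; linarith)
  have htc_mk : ∀ (j : Fin n) (t : ℝ) (ht : |t| < 1 + θ),
      ((mk j t ht : U) : EuclideanSpace ℝ (Fin 1)) 0 - c (idx (mk j t ht)) = t := fun j t ht => by
    rw [hidx_mk j t ht, hmk0 j t ht, add_sub_cancel_left]
  have hmk_eq : ∀ (y : U) (ht : |(y : EuclideanSpace ℝ (Fin 1)) 0 - c (idx y)| < 1 + θ),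
      mk (idx y) ((y : EuclideanSpace ℝ (Fin 1)) 0 - c (idx y)) ht = y := fun y ht => by
    refine Subtype.ext ?_
    change (c (idx y) + ((y : EuclideanSpace ℝ (Fin 1)) 0 - c (idx y))) • e₀ = _
    rw [add_sub_cancel, ← hpt]
  have hU_ext : ∀ y y' : U, idx y = idx y' →
      (y : EuclideanSpace ℝ (Fin 1)) 0 - c (idx y) = (y' : EuclideanSpace ℝ (Fin 1)) 0 - c (idx y') →
      y = y' := fun y y' h1 h2 => by
    apply Subtype.ext
    rw [hpt (y : EuclideanSpace ℝ (Fin 1)), hpt (y' : EuclideanSpace ℝ (Fin 1))]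
    rw [h1] at h2
    have : (y : EuclideanSpace ℝ (Fin 1)) 0 = (y' : EuclideanSpace ℝ (Fin 1)) 0 := by linarith
    rw [this]
  have htcU : ∀ y : U, |(y : EuclideanSpace ℝ (Fin 1)) 0 - c (idx y)| < 1 + θ := hidx
  -- ### the glued homotopy on `ℝ × U`
  set Gsrc : ℝ × U → X := fun p =>
    g (idx p.2) (p.1, (p.2 : EuclideanSpace ℝ (Fin 1)) 0 - c (idx p.2)) with hGsrc
  have hval : ContMDiff (𝓡 1) (𝓡 1) ∞ (Subtype.val : U → EuclideanSpace ℝ (Fin 1)) :=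
    contMDiff_subtype_val
  have hcoordj : ∀ j : Fin n, ContMDiff (𝓘(ℝ, ℝ).prod (𝓡 1)) 𝓘(ℝ, ℝ × ℝ) ∞
      (fun p : ℝ × U => ((p.1, (p.2 : EuclideanSpace ℝ (Fin 1)) 0 - c j) : ℝ × ℝ)) := by
    intro j
    refine contMDiff_fst.prodMk_space ?_
    have h1 : ContMDiff (𝓡 1) 𝓘(ℝ, ℝ) ∞ (fun w : EuclideanSpace ℝ (Fin 1) => w 0 - c j) :=
      (hproj.sub contDiff_const).contMDiff
    exact h1.comp (hval.comp contMDiff_snd)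
  have hVo : ∀ j : Fin n, IsOpen {y : U | |(y : EuclideanSpace ℝ (Fin 1)) 0 - c j| < 1 + θ} :=
    fun j => isOpen_lt (((hprojc.comp continuous_subtype_val).sub continuous_const).abs)
      continuous_const
  have hVo' : ∀ j : Fin n, IsOpen {p : ℝ × U | |(p.2 : EuclideanSpace ℝ (Fin 1)) 0 - c j| < 1 + θ} :=
    fun j => (hVo j).preimage continuous_snd
  have hGsrc_loc : ∀ (j : Fin n) (p₀ : ℝ × U), idx p₀.2 = j →
      Gsrc =ᶠ[𝓝 p₀] fun p => g j (p.1, (p.2 : EuclideanSpace ℝ (Fin 1)) 0 - c j) := by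
    intro j p₀ hj
    have hp₀ : |(p₀.2 : EuclideanSpace ℝ (Fin 1)) 0 - c j| < 1 + θ := hj ▸ hidx p₀.2
    filter_upwards [(hVo' j).mem_nhds hp₀] with p hp
    simp only [hGsrc]
    have hp' : |(p.2 : EuclideanSpace ℝ (Fin 1)) 0 - c j| < 1 + θ := hp
    rw [hidx_eq p.2 j (by linarith)]
  have hGs : ContMDiff (𝓘(ℝ, ℝ).prod (𝓡 1)) (𝓡 d) ∞ Gsrc := fun p₀ =>
    (((hg _).comp (hcoordj (idx p₀.2))) p₀).congr_of_eventuallyEq (hGsrc_loc _ p₀ rfl)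
  -- ### charts of `U`
  have hext : ∀ u y : U, extChartAt (𝓡 1) u y = (y : EuclideanSpace ℝ (Fin 1)) := fun u y => rfl
  have hchartsrc : ∀ u : U, (chartAt (EuclideanSpace ℝ (Fin 1)) u).source = univ := fun u => by
    rw [TopologicalSpace.Opens.chartAt_eq, OpenPartialHomeomorph.subtypeRestr_source]
    simp
  have hball : ∀ (u : U) (r : ℝ) (y : U), y ∈ chartBall (𝓡 1) u r →
      |(y : EuclideanSpace ℝ (Fin 1)) 0 - (u : EuclideanSpace ℝ (Fin 1)) 0| ≤ r := by
    intro u r y hy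
    have h := (mem_chartBall.1 hy).2
    rwa [hext, hext, hdist] at h
  -- ### sets of the bookkeeping
  set A₀ : Set (ℝ × U) := {q | q.1 ≤ 1 / 4 ∨ 3 / 4 ≤ q.1} with hA₀
  set Band : Set (ℝ × U) := {q | b < |(q.2 : EuclideanSpace ℝ (Fin 1)) 0 - c (idx q.2)|} with hBand
  have hKc : ∀ β : ℝ, β < 1 + θ →
      IsCompact {y : U | |(y : EuclideanSpace ℝ (Fin 1)) 0 - c (idx y)| ≤ β} := by
    intro β hβ
    have habsβ : ∀ t : Icc (-β) β, |(t : ℝ)| < 1 + θ := fun t =>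
      lt_of_le_of_lt (abs_le.2 ⟨t.2.1, t.2.2⟩) hβ
    have heq : {y : U | |(y : EuclideanSpace ℝ (Fin 1)) 0 - c (idx y)| ≤ β} =
        ⋃ j : Fin n, range fun t : Icc (-β) β => mk j t (habsβ t) := by
      ext y
      simp only [mem_setOf_eq, mem_iUnion, mem_range]
      constructor
      · intro hy
        exact ⟨idx y, ⟨_, abs_le.1 hy⟩, hmk_eq y (hidx y)⟩
      · rintro ⟨j, t, rfl⟩
        rw [htc_mk j t (habsβ t)]
        exact abs_le.2 ⟨t.2.1, t.2.2⟩
    rw [heq]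
    refine isCompact_iUnion fun j => isCompact_range ?_
    refine Continuous.subtype_mk ?_ _
    exact ((continuous_const.add continuous_subtype_val).smul continuous_const)
  -- ### boxes, radii and bumps
  have hbox : ∀ p : ℝ × U, ∃ δ r : ℝ, 0 < δ ∧ δ ≤ 1 / 20 ∧ 0 < r ∧
      closedBall (extChartAt (𝓡 1) p.2 p.2) (3 * r) ⊆ (extChartAt (𝓡 1) p.2).target ∧
      MapsTo Gsrc (cbox (𝓡 1) p.1 (3 * δ) p.2 (3 * r))
        (chartAt (EuclideanSpace ℝ (Fin d)) (Gsrc p)).source := fun p =>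
    exists_box_radii (I := 𝓡 1) hGs.continuous p
      (chartAt (EuclideanSpace ℝ (Fin d)) (Gsrc p)).open_source (mem_chart_source _ _)
      (δ₀ := 1 / 20) (by norm_num)
  choose δ r₀ hδ hδle hr₀ htgt₀ hmaps₀ using hbox
  set r : ℝ × U → ℝ := fun p => min (r₀ p) (ε / 4) with hr
  have hrpos : ∀ p, 0 < r p := fun p => lt_min (hr₀ p) (by linarith)
  have hrle : ∀ p, r p ≤ r₀ p := fun p => min_le_left _ _
  have hrε : ∀ p, r p ≤ ε / 4 := fun p => min_le_right _ _
  have htgt : ∀ p, closedBall (extChartAt (𝓡 1) p.2 p.2) (3 * r p) ⊆ (extChartAt (𝓡 1) p.2).target :=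
    fun p => (closedBall_subset_closedBall (by linarith [hrle p])).trans (htgt₀ p)
  have h2r : ∀ p, closedBall (extChartAt (𝓡 1) p.2 p.2) (2 * r p) ⊆ (extChartAt (𝓡 1) p.2).target :=
    fun p => (closedBall_subset_closedBall (by linarith [hrpos p])).trans (htgt p)
  have hmaps : ∀ p, MapsTo Gsrc (cbox (𝓡 1) p.1 (3 * δ p) p.2 (3 * r p))
      (chartAt (EuclideanSpace ℝ (Fin d)) (Gsrc p)).source := fun p =>
    (hmaps₀ p).mono_left (cbox_mono (𝓡 1) p.1 p.2 le_rfl (by linarith [hrle p]))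
  have hbump : ∀ p : ℝ × U, ∃ ρ : ℝ × U → ℝ, ContMDiff (𝓘(ℝ, ℝ).prod (𝓡 1)) 𝓘(ℝ, ℝ) ∞ ρ ∧
      (∀ q, 0 ≤ ρ q) ∧ (∀ q, ρ q ≤ 1) ∧ (∀ q ∈ cbox (𝓡 1) p.1 (δ p) p.2 (r p), ρ q = 1) ∧
      tsupport ρ ⊆ cbox (𝓡 1) p.1 (2 * δ p) p.2 (2 * r p) := fun p =>
    exists_boxBump (I := 𝓡 1) (τ := p.1) (hδ p) (hrpos p) (h2r p)
  choose ρ hρs hρ0 hρ1 hρone hρsupp using hbump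
  have hgrip : ∀ p q, ρ p q ≠ 0 → q ∈ cbox (𝓡 1) p.1 (2 * δ p) p.2 (2 * r p) := fun p q h =>
    hρsupp p (subset_tsupport _ (mem_support.2 h))
  -- ### the compact set to be covered and the finite cover
  set Q : Set (ℝ × U) := Icc (1 / 4 : ℝ) (3 / 4) ×ˢ
    {y : U | |(y : EuclideanSpace ℝ (Fin 1)) 0 - c (idx y)| ≤ b} with hQ
  have hQc : IsCompact Q := isCompact_Icc.prod (hKc b (by linarith))
  obtain ⟨s, hsQ, hcover⟩ := hQc.elim_nhds_subcover (fun p => obox (𝓡 1) p.1 (δ p) p.2 (r p))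
    fun p _ => (isOpen_obox (𝓡 1) _ _ _ _).mem_nhds (self_mem_obox (𝓡 1) p.1 p.2 (hδ p) (hrpos p))
  -- ### the constraint "`[0, 1] × {|t| ≤ b + ε}` is mapped off `Z`"
  set CZ : Set (ℝ × U) := Icc (0 : ℝ) 1 ×ˢ
    {y : U | |(y : EuclideanSpace ℝ (Fin 1)) 0 - c (idx y)| ≤ b + ε} with hCZ
  have hCZc : IsCompact CZ := isCompact_Icc.prod (hKc (b + ε) (by linarith))
  have hCZ0 : MapsTo Gsrc CZ Zᶜ := by
    rintro ⟨s', y⟩ ⟨hs', hy⟩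
    exact hgZ _ _ hs' _ (by linarith [hy.out])
  -- ### the finite chart cover of `U`
  have hF : ∃ F : Finset U, ∀ u : U, ∃ v ∈ F, u ∈ (chartAt (EuclideanSpace ℝ (Fin 1)) v).source := by
    rcases isEmpty_or_nonempty U with hUe | ⟨⟨v⟩⟩
    · exact ⟨∅, fun u => (IsEmpty.false u).elim⟩
    · exact ⟨{v}, fun u => ⟨v, Finset.mem_singleton_self v, by rw [hchartsrc]; exact mem_univ _⟩⟩
  have hd' : 2 * 1 + 2 ≤ d := by omega
  -- ### transfer of the differential condition between `U`, `ℝ¹` and `ℝ`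
  have hinjP : Injective (EuclideanSpace.proj (0 : Fin 1) : EuclideanSpace ℝ (Fin 1) → ℝ) := by
    intro w w' h
    refine PiLp.ext fun i => ?_
    fin_cases i
    exact h
  have hsurjP : Surjective (EuclideanSpace.proj (0 : Fin 1) : EuclideanSpace ℝ (Fin 1) → ℝ) :=
    fun t => ⟨t • e₀, hsm0 t⟩
  have hPder : ∀ (j : Fin n) (w : EuclideanSpace ℝ (Fin 1)),
      HasMFDerivAt (𝓡 1) 𝓘(ℝ, ℝ) (fun w : EuclideanSpace ℝ (Fin 1) => w 0 - c j) w
        (EuclideanSpace.proj (0 : Fin 1) : EuclideanSpace ℝ (Fin 1) →L[ℝ] ℝ) := fun j w =>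
    (((EuclideanSpace.proj (0 : Fin 1) : EuclideanSpace ℝ (Fin 1) →L[ℝ] ℝ).hasFDerivAt
      (x := w)).sub_const (c j)).hasMFDerivAt
  have htransfer : ∀ (φ : ℝ → X) (φU : U → X) (u : U) (j : Fin n),
      MDifferentiableAt 𝓘(ℝ, ℝ) (𝓡 d) φ ((u : EuclideanSpace ℝ (Fin 1)) 0 - c j) →
      (φU =ᶠ[𝓝 u] fun u' => φ ((u' : EuclideanSpace ℝ (Fin 1)) 0 - c j)) →
      (Injective (mfderiv (𝓡 1) (𝓡 d) φU u) ↔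
        Injective (mfderiv 𝓘(ℝ, ℝ) (𝓡 d) φ ((u : EuclideanSpace ℝ (Fin 1)) 0 - c j))) := by
    intro φ φU u j hφ hev
    have hA := hφ.hasMFDerivAt.comp (u : EuclideanSpace ℝ (Fin 1)) (hPder j _)
    have hB := hA.comp u (OpenSubmanifold.hasMFDerivAt_subtype_val u)
    have hC : HasMFDerivAt (𝓡 1) (𝓡 d) φU u
        (((mfderiv 𝓘(ℝ, ℝ) (𝓡 d) φ ((u : EuclideanSpace ℝ (Fin 1)) 0 - c j)).comp
          (EuclideanSpace.proj (0 : Fin 1) : EuclideanSpace ℝ (Fin 1) →L[ℝ] ℝ)).comp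
          (ContinuousLinearMap.id ℝ (EuclideanSpace ℝ (Fin 1)))) :=
      hB.congr_of_eventuallyEq hev
    rw [hC.mfderiv]
    change Injective ((⇑(mfderiv 𝓘(ℝ, ℝ) (𝓡 d) φ ((u : EuclideanSpace ℝ (Fin 1)) 0 - c j)) ∘
      (EuclideanSpace.proj (0 : Fin 1) : EuclideanSpace ℝ (Fin 1) → ℝ)) ∘ id) ↔ _
    rw [Function.comp_id]
    exact ⟨fun h => h.of_comp_right hsurjP, fun h => h.comp hinjP⟩
  have hmdW : ∀ (a : ℝ → X), ContMDiffOn 𝓘(ℝ, ℝ) (𝓡 d) ∞ a W → ∀ t, |t| < 1 + θ →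
      MDifferentiableAt 𝓘(ℝ, ℝ) (𝓡 d) a t := fun a ha t ht =>
    ((ha t (htW t ht)).contMDiffAt (hW.mem_nhds (htW t ht))).mdifferentiableAt (by simp)
  -- ### goodness of the initial family
  have hstage_loc : ∀ (a : Fin n → ℝ → X) (P : ℝ → Prop), IsOpen {t | P t} → ∀ s' : ℝ,
      (∀ j t, P t → |t| ≤ 1 + θ → g j (s', t) = a j t) →
      ∀ u : U, P ((u : EuclideanSpace ℝ (Fin 1)) 0 - c (idx u)) →
      (fun u' : U => Gsrc (s', u')) =ᶠ[𝓝 u]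
        fun u' => a (idx u) ((u' : EuclideanSpace ℝ (Fin 1)) 0 - c (idx u)) := by
    intro a P hP s' hga u hu
    have ho : IsOpen {u' : U | |(u' : EuclideanSpace ℝ (Fin 1)) 0 - c (idx u)| < 1 + θ ∧
        P ((u' : EuclideanSpace ℝ (Fin 1)) 0 - c (idx u))} :=
      (hVo (idx u)).inter (hP.preimage ((hprojc.comp continuous_subtype_val).sub continuous_const))
    filter_upwards [ho.mem_nhds ⟨hidx u, hu⟩] with u' hu'
    simp only [hGsrc]
    rw [hidx_eq u' (idx u) (by linarith [hu'.1])]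
    exact hga _ _ hu'.2 hu'.1.le
  have himm0 : ∀ q ∈ A₀ ∪ Band, Injective (mfderiv (𝓡 1) (𝓡 d) (fun u => Gsrc (q.1, u)) q.2) := by
    rintro ⟨s', u⟩ hq
    rcases hq with (hs' | hs') | hb'
    · have hev := hstage_loc a₀ (fun _ => True) isOpen_univ s'
        (fun j t _ ht => hg0 j s' t hs' ht) u trivial
      exact (htransfer (a₀ (idx u)) _ u (idx u) (hmdW _ (ha₀ _).1 _ (htcU u)) hev).2
        ((ha₀ _).2.2 _ (htW _ (htcU u)))
    · have hev := hstage_loc a₁ (fun _ => True) isOpen_univ s'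
        (fun j t _ ht => hg1 j s' t hs' ht) u trivial
      exact (htransfer (a₁ (idx u)) _ u (idx u) (hmdW _ (ha₁ _).1 _ (htcU u)) hev).2
        ((ha₁ _).2.2 _ (htW _ (htcU u)))
    · have hev := hstage_loc a₀ (fun t => b < |t|) (isOpen_lt continuous_const continuous_abs) s'
        (fun j t hbt ht => hgb j s' t (le_of_lt hbt) ht) u hb'
      exact (htransfer (a₀ (idx u)) _ u (idx u) (hmdW _ (ha₀ _).1 _ (htcU u)) hev).2
        ((ha₀ _).2.2 _ (htW _ (htcU u)))
  have hsep : ∀ (a : Fin n → ℝ → X), (∀ j, InjOn (a j) W) →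
      (∀ j l, j ≠ l → ∀ t ∈ W, ∀ s ∈ W, a j t ≠ a l s) →
      ∀ (j l : Fin n) (t t' : ℝ), |t| < 1 + θ → |t'| < 1 + θ → a j t = a l t' → j = l ∧ t = t' := by
    intro a hainj hadis j l t t' ht ht' heq
    have hjl : j = l := by
      by_contra hjl
      exact hadis j l hjl t (htW t ht) t' (htW t' ht') heq
    subst hjl
    exact ⟨rfl, hainj j (htW t ht) (htW t' ht') heq⟩
  have hGsrc_val : ∀ (s' : ℝ) (u : U), Gsrc (s', u) =
      g (idx u) (s', (u : EuclideanSpace ℝ (Fin 1)) 0 - c (idx u)) := fun s' u => rfl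
  have hinj0 : ∀ q ∈ A₀, ∀ u', Gsrc (q.1, u') = Gsrc q → u' = q.2 := by
    rintro ⟨s', u⟩ hq u' heq
    change Gsrc (s', u') = Gsrc (s', u) at heq
    rw [hGsrc_val, hGsrc_val] at heq
    rcases hq with hs' | hs'
    · rw [hg0 _ _ _ hs' (htcU u').le, hg0 _ _ _ hs' (htcU u).le] at heq
      obtain ⟨h1, h2⟩ := hsep a₀ (fun j => (ha₀ j).2.1) hd₀ _ _ _ _ (htcU u') (htcU u) heq
      exact hU_ext u' u h1 h2
    · rw [hg1 _ _ _ hs' (htcU u').le, hg1 _ _ _ hs' (htcU u).le] at heq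
      obtain ⟨h1, h2⟩ := hsep a₁ (fun j => (ha₁ j).2.1) hd₁ _ _ _ _ (htcU u') (htcU u) heq
      exact hU_ext u' u h1 h2
  -- ### the induction over the boxes
  have hind : ∀ S : Finset (ℝ × U), S ⊆ s → ∃ G' : ℝ × U → X,
      ContMDiff (𝓘(ℝ, ℝ).prod (𝓡 1)) (𝓡 d) ∞ G' ∧
      (∀ q ∈ (A₀ ∪ Band) ∪ ⋃ p ∈ S, (cbox (𝓡 1) p.1 (δ p) p.2 (r p) ∪ {q | ρ p q ≠ 0}),
        Injective (mfderiv (𝓡 1) (𝓡 d) (fun u => G' (q.1, u)) q.2)) ∧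
      (∀ q ∈ A₀ ∪ ⋃ p ∈ S, (cbox (𝓡 1) p.1 (δ p) p.2 (r p) ∪ {q | ρ p q ≠ 0}),
        ∀ u', G' (q.1, u') = G' q → u' = q.2) ∧
      (∀ p ∈ s, MapsTo G' (cbox (𝓡 1) p.1 (3 * δ p) p.2 (3 * r p))
        (chartAt (EuclideanSpace ℝ (Fin d)) (Gsrc p)).source) ∧
      MapsTo G' CZ Zᶜ ∧
      ∀ q, (∀ p ∈ S, ρ p q = 0) → G' q = Gsrc q := by
    intro S
    induction S using Finset.induction_on with
    | empty =>
      intro _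
      refine ⟨Gsrc, hGs, fun q hq => ?_, fun q hq => ?_, fun p _ => hmaps p, hCZ0, fun q _ => rfl⟩
      · simp only [Finset.notMem_empty, iUnion_of_empty, iUnion_empty, union_empty] at hq
        exact himm0 q hq
      · simp only [Finset.notMem_empty, iUnion_of_empty, iUnion_empty, union_empty] at hq
        exact hinj0 q hq
    | @insert p₀ S hp₀S ih =>
      intro hins
      obtain ⟨G', hG's, hG'imm, hG'inj, hG'maps, hG'Z, hG'eq⟩ :=
        ih ((Finset.subset_insert p₀ S).trans hins)
      have hp₀ : p₀ ∈ s := hins (Finset.mem_insert_self p₀ S)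
      have hRM : cbox (𝓡 1) p₀.1 (3 * δ p₀) p₀.2 (3 * r p₀) ⊆
          (univ : Set ℝ) ×ˢ (chartAt (EuclideanSpace ℝ (Fin 1)) p₀.2).source := by
        rw [← extChartAt_source (𝓡 1)]
        exact cbox_subset_prod_source (𝓡 1) _ _ _ _
      have step := exists_boxPerturb_good_of_finite_atlas' hF hd' hG's hG'imm hG'inj
        (x := Gsrc p₀) (u₀ := p₀.2) (hρs p₀) (hρ0 p₀) (hρ1 p₀)
        (K := cbox (𝓡 1) p₀.1 (δ p₀) p₀.2 (r p₀) ∪ {q | ρ p₀ q ≠ 0})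
        (fun q hq => hq.elim (fun h => by rw [hρone p₀ q h]; exact one_ne_zero) fun h => h)
        (isOpen_obox (𝓡 1) p₀.1 (3 * δ p₀) p₀.2 (3 * r p₀))
        ((hρsupp p₀).trans (cbox_subset_obox (𝓡 1) p₀.1 p₀.2 (by linarith [hδ p₀])
          (by linarith [hrpos p₀])))
        (obox_subset_cbox (𝓡 1) _ _ _ _) (isCompact_cbox (htgt p₀)) hRM (hG'maps p₀ hp₀)
        (ι := Option s)
        (C := fun o => Option.elim o CZ fun i => cbox (𝓡 1) i.1.1 (3 * δ i.1) i.1.2 (3 * r i.1))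
        (U := fun o => Option.elim o Zᶜ fun i =>
          (chartAt (EuclideanSpace ℝ (Fin d)) (Gsrc i.1)).source)
        (fun o => by
          cases o with
          | none => exact hCZc
          | some i => exact isCompact_cbox (htgt i.1))
        (fun o => by
          cases o with
          | none => exact hZ.isOpen_compl
          | some i => exact (chartAt (EuclideanSpace ℝ (Fin d)) (Gsrc i.1)).open_source)
        (fun o => by
          cases o with
          | none => exact hG'Z
          | some i => exact hG'maps i.1 i.2)
      obtain ⟨cc, hG''s, hG''imm, hG''inj, hG''maps, hG''eq⟩ := step
      have hsub : ∀ B : Set (ℝ × U),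
          B ∪ (⋃ p ∈ insert p₀ S, (cbox (𝓡 1) p.1 (δ p) p.2 (r p) ∪ {q | ρ p q ≠ 0})) ⊆
          (B ∪ ⋃ p ∈ S, (cbox (𝓡 1) p.1 (δ p) p.2 (r p) ∪ {q | ρ p q ≠ 0})) ∪
            (cbox (𝓡 1) p₀.1 (δ p₀) p₀.2 (r p₀) ∪ {q | ρ p₀ q ≠ 0}) := by
        intro B q hq
        rw [Finset.set_biUnion_insert] at hq
        rcases hq with hq | hq | hq
        · exact Or.inl (Or.inl hq)
        · exact Or.inr hq
        · exact Or.inl (Or.inr hq)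
      refine ⟨_, hG''s, fun q hq => hG''imm q (hsub _ hq), fun q hq => hG''inj q (hsub _ hq),
        fun p hp => hG''maps (some ⟨p, hp⟩), hG''maps none, fun q hq => ?_⟩
      rw [hG''eq q (hq p₀ (Finset.mem_insert_self p₀ S)),
        hG'eq q fun p hp => hq p (Finset.mem_insert_of_mem hp)]
  obtain ⟨GU, hGUs, hGUimm, hGUinj, -, hGUZ, hGUeq⟩ := hind s (Finset.Subset.refl s)
  -- ### where the bumps grip
  have hgrip_t : ∀ p ∈ s, ∀ q, ρ p q ≠ 0 → q.1 ∈ Ioo (1 / 8 : ℝ) (7 / 8) := by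
    intro p hp q h
    obtain ⟨⟨h1, h2⟩, -⟩ := hgrip p q h
    obtain ⟨hτ1, hτ2⟩ := (hsQ p hp).1
    have := hδle p
    exact ⟨by linarith, by linarith⟩
  have hgrip_y : ∀ p ∈ s, ∀ q, ρ p q ≠ 0 →
      |(q.2 : EuclideanSpace ℝ (Fin 1)) 0 - c (idx q.2)| ≤ b + ε / 2 := by
    intro p hp q h
    obtain ⟨-, hy⟩ := hgrip p q h
    have h1 := hball _ _ _ hy
    have h2 : |(p.2 : EuclideanSpace ℝ (Fin 1)) 0 - c (idx p.2)| ≤ b := (hsQ p hp).2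
    have h3 := hrε p
    have h4 : |(q.2 : EuclideanSpace ℝ (Fin 1)) 0 - c (idx p.2)| ≤ b + ε / 2 := by
      rw [show (q.2 : EuclideanSpace ℝ (Fin 1)) 0 - c (idx p.2) =
        ((q.2 : EuclideanSpace ℝ (Fin 1)) 0 - (p.2 : EuclideanSpace ℝ (Fin 1)) 0) +
          ((p.2 : EuclideanSpace ℝ (Fin 1)) 0 - c (idx p.2)) by ring]
      exact (abs_add_le _ _).trans (by linarith)
    rwa [hidx_eq q.2 (idx p.2) (by linarith)]
  have hvanish : ∀ q : ℝ × U, (q.1 ≤ 1 / 8 ∨ 7 / 8 ≤ q.1 ∨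
      b + ε / 2 < |(q.2 : EuclideanSpace ℝ (Fin 1)) 0 - c (idx q.2)|) → ∀ p ∈ s, ρ p q = 0 := by
    intro q hq p hp
    by_contra h
    rcases hq with hq | hq | hq
    · linarith [(hgrip_t p hp q h).1]
    · linarith [(hgrip_t p hp q h).2]
    · linarith [hgrip_y p hp q h]
  -- ### coverage by the final good sets
  have hT : ∀ q : ℝ × U, q ∉ A₀ → |(q.2 : EuclideanSpace ℝ (Fin 1)) 0 - c (idx q.2)| ≤ b →
      q ∈ ⋃ p ∈ s, (cbox (𝓡 1) p.1 (δ p) p.2 (r p) ∪ {q | ρ p q ≠ 0}) := by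
    intro q hq hb'
    have hq1 : q.1 ∈ Icc (1 / 4 : ℝ) (3 / 4) := by
      simp only [hA₀, mem_setOf_eq, not_or, not_le] at hq
      exact ⟨hq.1.le, hq.2.le⟩
    obtain ⟨p, hp, hqp⟩ := mem_iUnion₂.1 (hcover (mk_mem_prod hq1 hb'))
    exact mem_iUnion₂.2 ⟨p, hp, Or.inl (obox_subset_cbox (𝓡 1) _ _ _ _ hqp)⟩
  have hcovimm : ∀ q : ℝ × U,
      q ∈ (A₀ ∪ Band) ∪ ⋃ p ∈ s, (cbox (𝓡 1) p.1 (δ p) p.2 (r p) ∪ {q | ρ p q ≠ 0}) := by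
    intro q
    by_cases hq : q ∈ A₀
    · exact Or.inl (Or.inl hq)
    by_cases hb' : b < |(q.2 : EuclideanSpace ℝ (Fin 1)) 0 - c (idx q.2)|
    · exact Or.inl (Or.inr hb')
    · exact Or.inr (hT q hq (not_lt.1 hb'))
  -- ### the perturbed homotopies on `ℝ × ℝ`
  have h0θ : |(0 : ℝ)| < 1 + θ := by rw [abs_zero]; linarith
  set fU : Fin n → ℝ × ℝ → U := fun j p =>
    if h : |p.2| < 1 + θ then mk j p.2 h else mk j 0 h0θ with hfU
  set G : Fin n → ℝ × ℝ → X := fun j p =>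
    if |p.2| < 1 + θ then GU (p.1, fU j p) else g j p with hGdef
  have hGval : ∀ (j : Fin n) (s' t : ℝ) (ht : |t| < 1 + θ), G j (s', t) = GU (s', mk j t ht) := by
    intro j s' t ht
    simp only [hGdef, hfU, if_pos ht, dif_pos ht]
  have hGout : ∀ (j : Fin n) (s' t : ℝ), ¬ |t| < 1 + θ → G j (s', t) = g j (s', t) := by
    intro j s' t ht
    simp only [hGdef, if_neg ht]
  have hGsrc_mk : ∀ (j : Fin n) (s' t : ℝ) (ht : |t| < 1 + θ),
      Gsrc (s', mk j t ht) = g j (s', t) := by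
    intro j s' t ht
    rw [hGsrc_val, htc_mk j t ht, hidx_mk j t ht]
  -- (O2): the homotopies are unchanged off `(1/8, 7/8)` and on the band
  have hO2 : ∀ j s' t, (s' ≤ 1 / 8 ∨ 7 / 8 ≤ s' ∨ b + ε ≤ |t|) → G j (s', t) = g j (s', t) := by
    intro j s' t h
    by_cases ht : |t| < 1 + θ
    · rw [hGval j s' t ht, hGUeq _ (hvanish _ ?_), hGsrc_mk j s' t ht]
      rcases h with h | h | h
      · exact Or.inl h
      · exact Or.inr (Or.inl h)
      · refine Or.inr (Or.inr ?_)
        rw [htc_mk j t ht]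
        linarith
    · exact hGout j s' t ht
  -- (O3): the constraint off `Z`
  have hO3 : ∀ j, ∀ s' ∈ Icc (0 : ℝ) 1, ∀ t, |t| ≤ b + 2 * ε → G j (s', t) ∉ Z := by
    intro j s' hs' t ht
    by_cases hbt : b + ε ≤ |t|
    · rw [hO2 j s' t (Or.inr (Or.inr hbt))]
      exact hgZ j s' hs' t ht
    · have ht' : |t| < 1 + θ := by linarith [not_le.1 hbt]
      rw [hGval j s' t ht']
      refine hGUZ (mk_mem_prod hs' ?_)
      change |((mk j t ht' : U) : EuclideanSpace ℝ (Fin 1)) 0 - c (idx (mk j t ht'))| ≤ b + ε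
      rw [htc_mk j t ht']
      linarith [not_le.1 hbt]
  -- (O1): smoothness
  have hO1 : ∀ j, ContMDiff 𝓘(ℝ, ℝ × ℝ) (𝓡 d) ∞ (G j) := by
    intro j p₀
    by_cases hp₀ : |p₀.2| < 1 + θ
    · have ho : IsOpen {p : ℝ × ℝ | |p.2| < 1 + θ} :=
        isOpen_lt (continuous_abs.comp continuous_snd) continuous_const
      have hev : G j =ᶠ[𝓝 p₀] fun p => GU (p.1, fU j p) := by
        filter_upwards [ho.mem_nhds hp₀] with p hp
        have hp' : |p.2| < 1 + θ := hp
        simp only [hGdef, if_pos hp']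
      have hfU_val : (Subtype.val ∘ fU j) =ᶠ[𝓝 p₀]
          fun p : ℝ × ℝ => (c j + p.2) • e₀ := by
        filter_upwards [ho.mem_nhds hp₀] with p hp
        have hp' : |p.2| < 1 + θ := hp
        simp only [comp_apply, hfU, dif_pos hp']
        rfl
      have hfUs : ContMDiffAt 𝓘(ℝ, ℝ × ℝ) (𝓡 1) ∞ (fU j) p₀ := by
        rw [← ContMDiffAt.subtypeVal_comp_iff]
        refine ContMDiffAt.congr_of_eventuallyEq ?_ hfU_val
        exact (((contDiff_const.add contDiff_snd).smul contDiff_const).contMDiff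
          (n := ∞)).contMDiffAt
      have hpair : ContMDiffAt 𝓘(ℝ, ℝ × ℝ) (𝓘(ℝ, ℝ).prod (𝓡 1)) ∞
          (fun p : ℝ × ℝ => (p.1, fU j p)) p₀ :=
        (contDiff_fst.contMDiff (n := ∞)).contMDiffAt.prodMk hfUs
      exact ((hGUs _).comp p₀ hpair).congr_of_eventuallyEq hev
    · have hb2 : b + ε / 2 < |p₀.2| := by linarith [not_lt.1 hp₀]
      have ho : IsOpen {p : ℝ × ℝ | b + ε / 2 < |p.2|} :=
        isOpen_lt continuous_const (continuous_abs.comp continuous_snd)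
      have hev : G j =ᶠ[𝓝 p₀] g j := by
        filter_upwards [ho.mem_nhds hb2] with p hp
        have hp' : b + ε / 2 < |p.2| := hp
        obtain ⟨s', t⟩ := p
        change b + ε / 2 < |t| at hp'
        by_cases hpt' : |t| < 1 + θ
        · rw [hGval j s' t hpt', hGUeq _ (hvanish _ (Or.inr (Or.inr ?_))), hGsrc_mk j s' t hpt']
          rw [htc_mk j t hpt']
          exact hp'
        · exact hGout j s' t hpt'
      exact ((hg j) p₀).congr_of_eventuallyEq hev
  -- (O4): immersivity of the curves
  have hO4 : ∀ j s' t, |t| ≤ 1 + θ / 2 →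
      Injective (mfderiv 𝓘(ℝ, ℝ) (𝓡 d) (fun t => G j (s', t)) t) := by
    intro j s' t ht
    have ht' : |t| < 1 + θ := by linarith
    have htu : ((mk j t ht' : U) : EuclideanSpace ℝ (Fin 1)) 0 - c j = t := by
      rw [hmk0 j t ht', add_sub_cancel_left]
    have hgood := hGUimm (s', mk j t ht') (hcovimm _)
    have hφ : ContMDiff 𝓘(ℝ, ℝ) (𝓡 d) ∞ fun t' => G j (s', t') :=
      (hO1 j).comp (contDiff_const.prodMk contDiff_id).contMDiff
    have hmd : MDifferentiableAt 𝓘(ℝ, ℝ) (𝓡 d) (fun t' => G j (s', t'))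
        (((mk j t ht' : U) : EuclideanSpace ℝ (Fin 1)) 0 - c j) :=
      (hφ _).mdifferentiableAt (by simp)
    have hev : (fun u' : U => GU (s', u')) =ᶠ[𝓝 (mk j t ht')]
        fun u' => (fun t' => G j (s', t')) ((u' : EuclideanSpace ℝ (Fin 1)) 0 - c j) := by
      filter_upwards [(hVo j).mem_nhds (show |((mk j t ht' : U) : EuclideanSpace ℝ (Fin 1)) 0 - c j|
        < 1 + θ by rw [htu]; exact ht')] with u' hu'
      have hu'' : |(u' : EuclideanSpace ℝ (Fin 1)) 0 - c j| < 1 + θ := hu'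
      have hj' : idx u' = j := hidx_eq u' j (by linarith)
      change GU (s', u') = G j (s', (u' : EuclideanSpace ℝ (Fin 1)) 0 - c j)
      rw [hGval j s' _ hu'']
      congr 2
      exact (hU_ext _ _ (by rw [hidx_mk j _ hu'', hj']) (by rw [htc_mk j _ hu'', hj'])).symm
    have key := (htransfer (fun t' => G j (s', t')) (fun u' => GU (s', u')) (mk j t ht') j hmd hev).1
      hgood
    rwa [htu] at key
  -- (O5): injectivity and disjointness of the curves
  have hO5 : ∀ s' j j' t t', |t| ≤ 1 + θ / 2 → |t'| ≤ 1 + θ / 2 → G j (s', t) = G j' (s', t') →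
      j = j' ∧ t = t' := by
    intro s' j j' t t' ht ht' heq
    have h1 : |t| < 1 + θ := by linarith
    have h2 : |t'| < 1 + θ := by linarith
    rw [hGval j s' t h1, hGval j' s' t' h2] at heq
    have hconcl : mk j t h1 = mk j' t' h2 → j = j' ∧ t = t' := fun h => by
      constructor
      · have := congrArg idx h
        rwa [hidx_mk j t h1, hidx_mk j' t' h2] at this
      · have := congrArg (fun u : U => (u : EuclideanSpace ℝ (Fin 1)) 0 - c (idx u)) h
        simp only at this
        rwa [htc_mk j t h1, htc_mk j' t' h2] at this
    by_cases hq : ((s', mk j t h1) : ℝ × U) ∈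
        A₀ ∪ ⋃ p ∈ s, (cbox (𝓡 1) p.1 (δ p) p.2 (r p) ∪ {q | ρ p q ≠ 0})
    · exact hconcl (hGUinj _ hq (mk j' t' h2) heq.symm).symm
    by_cases hq' : ((s', mk j' t' h2) : ℝ × U) ∈
        A₀ ∪ ⋃ p ∈ s, (cbox (𝓡 1) p.1 (δ p) p.2 (r p) ∪ {q | ρ p q ≠ 0})
    · exact hconcl (hGUinj _ hq' (mk j t h1) heq)
    -- both points are unperturbed band points: the stage is `a₀` there
    have hnA : ((s', mk j t h1) : ℝ × U) ∉ A₀ := fun h => hq (Or.inl h)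
    have hnA' : ((s', mk j' t' h2) : ℝ × U) ∉ A₀ := fun h => hq' (Or.inl h)
    have hbu : b < |t| := by
      by_contra h
      refine hq (Or.inr (hT _ hnA ?_))
      change |((mk j t h1 : U) : EuclideanSpace ℝ (Fin 1)) 0 - c (idx (mk j t h1))| ≤ b
      rw [htc_mk j t h1]
      exact not_lt.1 h
    have hbu' : b < |t'| := by
      by_contra h
      refine hq' (Or.inr (hT _ hnA' ?_))
      change |((mk j' t' h2 : U) : EuclideanSpace ℝ (Fin 1)) 0 - c (idx (mk j' t' h2))| ≤ b
      rw [htc_mk j' t' h2]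
      exact not_lt.1 h
    have hρu : ∀ p ∈ s, ρ p (s', mk j t h1) = 0 := fun p hp => by
      by_contra h
      exact hq (Or.inr (mem_iUnion₂.2 ⟨p, hp, Or.inr h⟩))
    have hρu' : ∀ p ∈ s, ρ p (s', mk j' t' h2) = 0 := fun p hp => by
      by_contra h
      exact hq' (Or.inr (mem_iUnion₂.2 ⟨p, hp, Or.inr h⟩))
    rw [hGUeq _ hρu, hGUeq _ hρu', hGsrc_mk j s' t h1, hGsrc_mk j' s' t' h2, hgb j s' t hbu.le h1.le,
      hgb j' s' t' hbu'.le h2.le] at heq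
    exact hsep a₀ (fun j => (ha₀ j).2.1) hd₀ _ _ _ _ h1 h2 heq
  exact ⟨G, hO1, hO2, hO3, hO4, hO5⟩

end Literature.Topology.FourManifolds
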